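import Literature.AlgebraicGeometry.ShimuraVarieties.UnitaryBallRealPoints
import HarnessLib

/-!
# The ball chart of the negative cone of a ball-quotient datum

Topic `AlgebraicGeometry/ShimuraVarieties`; namespace
`Literature.AlgebraicGeometry.ShimuraVarieties.UnitaryBallUniformisationDatum` (datum API, continued from
`UnitaryBallRealPoints`). Everything here is a definition or a PROVED lemma (Mathlib + tree).

For `D : UnitaryBallUniformisationDatum 2 X` and a Sylvester frame `𝔣` (`Tᴴ H^{τ₁} T = J`), the chart of
the negative cone onto the tree's unit ball `BallModel.Ball`, `D.coneChart 𝔣 v = proj (T⁻¹ v)`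
(BMM Part 2 §1.3: the ball is the space of negative lines): continuous (`continuous_coneChart`),
equivariant for `D.frameIso 𝔣 : D.realPoints ≃* U21` (`coneChart_smul`), constant exactly on the
punctured complex lines (`coneChart_eq_iff`), onto with the continuous section
`D.coneLift 𝔣 z = T (z, 1)` (`coneChart_coneLift`). Consequently `D.realPoints` is transitive on the
negative lines (`exists_smul_eq_smul_of_mem_cone`, from the tree's `BallModel.transitive`).

This is the bridge between the datum's CONE presentation of `Γ \\ 𝔹` (BMM) and the tree's affine
BALL model with its Jacobian cocycle (`UnitBallJacobian`), on which automorphic one-forms are typed.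
-/

noncomputable section

open Matrix
open Literature.Geometry.ComplexHyperbolic
open Literature.Geometry.ComplexHyperbolic.BallModel (U21 Ball Q proj mat x₀)

namespace Literature.AlgebraicGeometry.ShimuraVarieties

namespace UnitaryBallUniformisationDatum

open Literature.AlgebraicGeometry.Motives (SchemeOver)

variable {X₂ : SchemeOver ℂ} (D₂ : UnitaryBallUniformisationDatum 2 X₂)

/-! ### The ball chart of the cone -/

/-- **The ball chart** `cone → 𝔹²`, `v ↦ proj (t⁻¹ v) = ((t⁻¹v)₀/(t⁻¹v)₂, (t⁻¹v)₁/(t⁻¹v)₂)`.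
[cite: BergeronMillsonMoeglin2016Balls, Part 2 §1.3] -/
def coneChart (𝔣 : D₂.SylvesterFrame) (v : D₂.cone) : Ball :=
  proj (𝔣.ti *ᵥ (v : Fin 3 → ℂ)) (𝔣.Q_ti_mulVec_neg v.2)

/-- Coordinates of the chart. [folklore] -/
theorem coneChart_val (𝔣 : D₂.SylvesterFrame) (v : D₂.cone) (i : Fin 2) :
    (D₂.coneChart 𝔣 v).1 i =
      (𝔣.ti *ᵥ (v : Fin 3 → ℂ)) (Fin.castSucc i) / (𝔣.ti *ᵥ (v : Fin 3 → ℂ)) 2 :=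
  BallModel.proj_val _ _ i

/-- `proj` is constant on punctured lines. [folklore] -/
theorem proj_smul {w : Fin 3 → ℂ} (hw : Q w < 0) {c : ℂ} (hc : c ≠ 0) (hcw : Q (c • w) < 0) :
    proj (c • w) hcw = proj w hw := by
  apply BallModel.Ball.ext; intro i
  rw [BallModel.proj_val, BallModel.proj_val, Pi.smul_apply, Pi.smul_apply, smul_eq_mul,
    smul_eq_mul, mul_div_mul_left _ _ hc]

/-- Two `J`-negative vectors with the same projection are proportional. [folklore] -/
theorem eq_smul_of_proj_eq {w w' : Fin 3 → ℂ} (hw : Q w < 0) (hw' : Q w' < 0)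
    (h : proj w hw = proj w' hw') : w = (w 2 / w' 2) • w' := by
  have h2 := BallModel.ne_zero_of_Q_neg hw
  have h2' := BallModel.ne_zero_of_Q_neg hw'
  have hi : ∀ i : Fin 2, w (Fin.castSucc i) / w 2 = w' (Fin.castSucc i) / w' 2 := fun i ↦ by
    rw [← BallModel.proj_val w hw, ← BallModel.proj_val w' hw', h]
  funext k
  fin_cases k
  · have := hi 0
    simp only [Fin.castSucc_zero] at this
    simp only [Fin.zero_eta, Pi.smul_apply, smul_eq_mul]
    rw [div_eq_div_iff h2 h2'] at this
    field_simp
    linear_combination this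
  · have := hi 1
    simp only [Fin.castSucc_one] at this
    simp only [Fin.mk_one, Pi.smul_apply, smul_eq_mul]
    rw [div_eq_div_iff h2 h2'] at this
    field_simp
    linear_combination this
  · simp only [Pi.smul_apply, smul_eq_mul]
    show w 2 = w 2 / w' 2 * w' 2
    rw [div_mul_cancel₀ _ h2']

/-- The chart is constant on punctured lines: `coneChart (c v) = coneChart v`. [folklore] -/
theorem coneChart_lineSMul (𝔣 : D₂.SylvesterFrame) {c : ℂ} (hc : c ≠ 0) (v : D₂.cone) :
    D₂.coneChart 𝔣 ⟨c • (v : Fin 3 → ℂ), smul_mem_negCone hc v.2⟩ = D₂.coneChart 𝔣 v := by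
  unfold coneChart
  simp only [mulVec_smul]
  exact proj_smul _ hc _

/-- **Fibres of the chart are the punctured lines**: `coneChart v = coneChart w ↔ v ∈ ℂˣ w`.
[folklore] -/
theorem coneChart_eq_iff (𝔣 : D₂.SylvesterFrame) (v w : D₂.cone) :
    D₂.coneChart 𝔣 v = D₂.coneChart 𝔣 w ↔
      ∃ c : ℂ, c ≠ 0 ∧ (v : Fin 3 → ℂ) = c • (w : Fin 3 → ℂ) := by
  constructor
  · intro h
    have hprop := eq_smul_of_proj_eq (𝔣.Q_ti_mulVec_neg v.2) (𝔣.Q_ti_mulVec_neg w.2) h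
    set c : ℂ := (𝔣.ti *ᵥ (v : Fin 3 → ℂ)) 2 / (𝔣.ti *ᵥ (w : Fin 3 → ℂ)) 2 with hc
    refine ⟨c, div_ne_zero (BallModel.ne_zero_of_Q_neg (𝔣.Q_ti_mulVec_neg v.2))
      (BallModel.ne_zero_of_Q_neg (𝔣.Q_ti_mulVec_neg w.2)), ?_⟩
    have := congrArg (fun u ↦ 𝔣.t *ᵥ u) hprop
    simpa only [mulVec_mulVec, 𝔣.t_mul_ti, one_mulVec, mulVec_smul] using this
  · rintro ⟨c, hc, hvw⟩
    have : v = ⟨c • (w : Fin 3 → ℂ), smul_mem_negCone hc w.2⟩ := Subtype.ext hvw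
    rw [this, coneChart_lineSMul _ _ hc]

/-- `lift (proj w) = w₂⁻¹ w`. [folklore] -/
theorem lift_proj {w : Fin 3 → ℂ} (hw : Q w < 0) :
    BallModel.lift (proj w hw) = (w 2)⁻¹ • w := by
  have h2 := BallModel.ne_zero_of_Q_neg hw
  funext k
  fin_cases k
  · simp [BallModel.lift, div_eq_inv_mul]
  · simp [BallModel.lift, div_eq_inv_mul]
  · simp [BallModel.lift, h2]

/-- **Equivariance of the chart**: `coneChart (g • v) = frameIso g • coneChart v`.
[cite: BergeronMillsonMoeglin2016Balls, Part 2 §1.3] -/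
theorem coneChart_smul (𝔣 : D₂.SylvesterFrame) (g : D₂.realPoints) (v : D₂.cone) :
    D₂.coneChart 𝔣 (g • v) = D₂.frameIso 𝔣 g • D₂.coneChart 𝔣 v := by
  have hv := 𝔣.Q_ti_mulVec_neg v.2
  have h2 := BallModel.ne_zero_of_Q_neg hv
  rw [BallModel.smul_def, BallModel.act]
  unfold coneChart
  have hW : BallModel.W3 (D₂.frameIso 𝔣 g) (proj (𝔣.ti *ᵥ (v : Fin 3 → ℂ)) hv) =
      ((𝔣.ti *ᵥ (v : Fin 3 → ℂ)) 2)⁻¹ • (𝔣.ti *ᵥ ((g • v : D₂.cone) : Fin 3 → ℂ)) := by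
    rw [BallModel.W3, lift_proj, mulVec_smul, mat_frameIso, ConeChart.coe_smul, mulVec_mulVec,
      mulVec_mulVec, Matrix.mul_assoc, Matrix.mul_assoc, 𝔣.t_mul_ti, Matrix.mul_one]
  simp only [hW]
  exact (proj_smul _ (inv_ne_zero h2) _).symm

/-- The section of the chart: `z ↦ t (z₀, z₁, 1)`, a cone vector. [folklore] -/
def coneLift (𝔣 : D₂.SylvesterFrame) (z : Ball) : D₂.cone :=
  ⟨𝔣.t *ᵥ BallModel.lift z, by
    rw [mem_negCone_iff, ← 𝔣.Q_ti_mulVec, mulVec_mulVec, 𝔣.ti_mul_t, one_mulVec, Complex.ofReal_re]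
    exact BallModel.Q_lift z⟩

/-- `coneChart (coneLift z) = z`: the chart is onto. [folklore] -/
theorem coneChart_coneLift (𝔣 : D₂.SylvesterFrame) (z : Ball) :
    D₂.coneChart 𝔣 (D₂.coneLift 𝔣 z) = z := by
  apply BallModel.Ball.ext; intro i
  rw [coneChart_val]
  fin_cases i <;> simp [coneLift, mulVec_mulVec, BallModel.lift]

/-- The chart is surjective. [folklore] -/
theorem coneChart_surjective (𝔣 : D₂.SylvesterFrame) : Function.Surjective (D₂.coneChart 𝔣) :=
  fun z ↦ ⟨D₂.coneLift 𝔣 z, D₂.coneChart_coneLift 𝔣 z⟩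

/-- The chart is continuous. [folklore] -/
theorem continuous_coneChart (𝔣 : D₂.SylvesterFrame) : Continuous (D₂.coneChart 𝔣) := by
  have hc : Continuous fun v : D₂.cone ↦ 𝔣.ti *ᵥ (v : Fin 3 → ℂ) :=
    continuous_const.matrix_mulVec continuous_subtype_val
  refine Continuous.subtype_mk (continuous_pi fun i ↦ ?_) _
  have h2 : ∀ v : D₂.cone, (𝔣.ti *ᵥ (v : Fin 3 → ℂ)) 2 ≠ 0 := fun v ↦
    BallModel.ne_zero_of_Q_neg (𝔣.Q_ti_mulVec_neg v.2)
  fin_cases i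
  · exact ((continuous_apply 0).comp hc).div ((continuous_apply 2).comp hc) h2
  · exact ((continuous_apply 1).comp hc).div ((continuous_apply 2).comp hc) h2

/-- **`G_D` is transitive on the negative lines** (from the tree's transitivity of `U(2,1)` on
`𝔹²`): for cone vectors `v, w` some `g ∈ G_D` carries the line of `v` to the line of `w`.
[cite: BergeronMillsonMoeglin2016Balls, Part 2 §1.3] -/
theorem exists_smul_eq_smul_of_mem_cone (𝔣 : D₂.SylvesterFrame) (v w : D₂.cone) :
    ∃ g : D₂.realPoints, ∃ c : ℂ, c ≠ 0 ∧
      ((g • v : D₂.cone) : Fin 3 → ℂ) = c • (w : Fin 3 → ℂ) := by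
  obtain ⟨h, hh⟩ := BallModel.transitive (D₂.coneChart 𝔣 v) (D₂.coneChart 𝔣 w)
  refine ⟨(D₂.frameIso 𝔣).symm h, ?_⟩
  rw [← coneChart_eq_iff, coneChart_smul, MulEquiv.apply_symm_apply]
  exact hh

end UnitaryBallUniformisationDatum

end Literature.AlgebraicGeometry.ShimuraVarieties

end
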